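import Summits.Schanuel.Schanuel.Theorems.ZilberEacGraphExpTranscendence
import HarnessLib

/-!
# The equimodular class, XXII: the algebraic core for SEVERAL branches — a relation for
# `exp(p(z) - P̃(z - L(z)))` makes `L` algebraic over `ℂ(z)` whenever `L'` is

HONEST FRAMING.  Cell `pub-schanuel` (Zilber's Exponential-Algebraic Closedness, case ladder;
host summit Schanuel), seat 2, gen 24.  Gen 23 (file XII, `not_algebraic_graphExp`) treated ONE
branch `y₀ = -B(x₀)/A(x₀)` of a `y₀`-linear fibre and ended in a contradiction with file II (the
logarithm of a non-constant RATIONAL function is transcendental).  For fibre curves of higher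
`y₀`-degree the branches `y₀ = ρ_i(x₀)` are ALGEBRAIC, and `log ρ_i` need not be decidable one at a
time; the contradiction is obtained in file XXVII from the SUM over all branches (Vieta:
`∏ ρ_i` is rational).  This file isolates the algebraic conclusion per branch:
* **`isAlgebraic_log_of_graphExp_relation`** — if `L` is analytic at `z₀` with `L' = g` near `z₀`,
  the germ of `g` is algebraic over `ℂ[z]`, `g(z₀) ≠ 1`, `deg P̃ ≥ 2`, and some nonzero
  `H ∈ ℂ[s][t]` has `H(z, exp(p(z) - P̃(z - L(z)))) = 0` near `z₀`, then the germ of `L` is algebraic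
  over `ℂ[z]` (minimal relation, differentiated: `(1 - g)·D·P̃'(z - L) = p'·D + E`, `D ≠ 0`);
* **`isAlgebraic_logDeriv_of_relation`** — if `ρ` is analytic and zero-free at `z₀` with
  `Q(z, ρ(z)) = 0` near `z₀` (`Q ≠ 0`) and `(Σ j q_j ρ^j)(z₀) ≠ 0`, then the germ of `ρ'/ρ` is
  algebraic over `ℂ[z]` (`E + (ρ'/ρ)·D = 0`);
* `AGerm.mk_finset_sum`, `isAlgebraic_finset_sum` (bookkeeping for the sum over branches).
[folklore differential algebra, made concrete]; nothing here is specific to Schanuel's conjecture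
(neither used nor implied); Mantova–Masser's question (PLMS 2024 §1 p. 5) and EC(3,2) stay OPEN.
-/

noncomputable section

open Filter Topology Polynomial

set_option linter.dupNamespace false

namespace Summit.Schanuel.Schanuel.Theorems

/-! ## Part A. Finite sums of germs -/

/-- **The germ of a finite sum is the sum of the germs.** [folklore] -/
theorem AGerm.mk_finset_sum {z₀ : ℂ} {ι : Type*} (s : Finset ι) {f : ι → ℂ → ℂ}
    (hf : ∀ i, AnalyticAt ℂ (f i) z₀) (hsum : AnalyticAt ℂ (fun z => ∑ i ∈ s, f i z) z₀) :
    AGerm.mk z₀ hsum = ∑ i ∈ s, AGerm.mk z₀ (hf i) := by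
  classical
  induction s using Finset.induction_on with
  | empty =>
    have h0 : AnalyticAt ℂ (fun _ : ℂ => (0 : ℂ)) z₀ := analyticAt_const
    rw [Finset.sum_empty]
    have e : AGerm.mk z₀ hsum = AGerm.mk z₀ h0 := AGerm.mk_congr _ _ fun z => by simp
    rw [e, ← map_zero (algebraMap ℂ (AGerm z₀)), ← AGerm.mk_const]
  | insert a s ha ih =>
    have hs : AnalyticAt ℂ (fun z => ∑ i ∈ s, f i z) z₀ :=
      Finset.analyticAt_fun_sum _ fun i _ => hf i
    rw [Finset.sum_insert ha, ← ih hs, ← AGerm.mk_add]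
    exact AGerm.mk_congr _ _ fun z => by simp [Finset.sum_insert ha]

/-- A finite sum of elements algebraic over `ℂ[zGerm]` is algebraic. [folklore] -/
theorem isAlgebraic_finset_sum {z₀ : ℂ} {ι : Type*} (s : Finset ι) {v : ι → AGerm z₀}
    (hv : ∀ i ∈ s, IsAlgebraic (Algebra.adjoin ℂ ({zGerm z₀} : Set (AGerm z₀))) (v i)) :
    IsAlgebraic (Algebra.adjoin ℂ ({zGerm z₀} : Set (AGerm z₀))) (∑ i ∈ s, v i) := by
  classical
  induction s using Finset.induction_on with
  | empty => rw [Finset.sum_empty]; exact isAlgebraic_zero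
  | insert a s ha ih =>
    rw [Finset.sum_insert ha]
    exact (hv a (Finset.mem_insert_self a s)).add
      (ih fun i hi => hv i (Finset.mem_insert_of_mem hi))

/-! ## Part B. The logarithmic derivative of an algebraic function is algebraic -/

/-- **`ρ'/ρ` is algebraic over `ℂ[z]` for an algebraic `ρ`.**  `ρ` analytic at `z₀` with
`ρ' = ρ·g` near `z₀` (`g` analytic at `z₀`), `Q(z, ρ z) = 0` near `z₀` for a nonzero
`Q ∈ ℂ[s][t]`, and the non-degeneracy `(Σ_j j q_j(z₀) ρ(z₀)^j) ≠ 0` (`= ρ ∂_t Q ≠ 0`: a simple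
root).  Then the germ of `g` is algebraic over `ℂ[zGerm]`: differentiating the relation gives
`E + g·D = 0` with `E = Σ q_j' ρ^j`, `D = Σ j q_j ρ^j ≠ 0`, both algebraic. [folklore] -/
theorem isAlgebraic_logDeriv_of_relation {z₀ : ℂ} {ρ g : ℂ → ℂ} (hρan : AnalyticAt ℂ ρ z₀)
    (hgan : AnalyticAt ℂ g z₀) (hρ : ∀ᶠ z in 𝓝 z₀, HasDerivAt ρ (ρ z * g z) z)
    {Q : ℂ[X][X]} (hQ0 : Q ≠ 0)
    (hQ : ∀ᶠ z in 𝓝 z₀, (Q.map (Polynomial.evalRingHom z)).eval (ρ z) = 0)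
    (hD : ((weightDeg Q).map (Polynomial.evalRingHom z₀)).eval (ρ z₀) ≠ 0) :
    IsAlgebraic (Algebra.adjoin ℂ ({zGerm z₀} : Set (AGerm z₀))) (AGerm.mk z₀ hgan) := by
  set ρO := AGerm.mk z₀ hρan with hρO
  set gO := AGerm.mk z₀ hgan with hgO
  set M := Q.natDegree with hM
  -- `ρ` is algebraic
  have hQO : germEval₂ z₀ ρO Q = 0 := (germEval₂_mk_eq_zero_iff hρan Q).2 hQ
  set Bz := Algebra.adjoin ℂ ({zGerm z₀} : Set (AGerm z₀)) with hBz
  have hρalg : IsAlgebraic Bz ρO := isAlgebraic_of_germEval₂_eq_zero ρO hQ0 hQO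
  -- the differentiated function identity
  have hF : (fun z => (Q.map (Polynomial.evalRingHom z)).eval (ρ z)) =ᶠ[𝓝 z₀] 0 := hQ
  have hFF : ∀ᶠ z in 𝓝 z₀, (fun y => (Q.map (Polynomial.evalRingHom y)).eval (ρ y)) =ᶠ[𝓝 z] 0 :=
    eventually_eventually_nhds.2 hF
  have hE : ∀ᶠ z in 𝓝 z₀, ((coeffDeriv Q).map (Polynomial.evalRingHom z)).eval (ρ z) +
      g z * ((weightDeg Q).map (Polynomial.evalRingHom z)).eval (ρ z) = 0 := by
    filter_upwards [hρ, hFF] with z hρz hFz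
    have e : (fun y => (Q.map (Polynomial.evalRingHom y)).eval (ρ y)) =
        fun y => ∑ j ∈ Finset.range (M + 1), (Q.coeff j).eval y * ρ y ^ j :=
      funext fun y => evalPP_eq_sum Q y (ρ y) (Nat.lt_succ_self _)
    have hderF : HasDerivAt (fun y => (Q.map (Polynomial.evalRingHom y)).eval (ρ y))
        (∑ j ∈ Finset.range (M + 1), ((derivative (Q.coeff j)).eval z * ρ z ^ j +
          (Q.coeff j).eval z * ((j : ℂ) * ρ z ^ (j - 1) * (ρ z * g z)))) z := by
      rw [e]
      exact HasDerivAt.fun_sum fun j _ => (Polynomial.hasDerivAt (Q.coeff j) z).fun_mul (hρz.fun_pow j)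
    have hzero := hderF.unique ((hasDerivAt_const z (0 : ℂ)).congr_of_eventuallyEq hFz)
    rw [eval_coeffDeriv, eval_weightDeg, Finset.mul_sum, ← Finset.sum_add_distrib, ← hzero]
    refine Finset.sum_congr rfl fun j _ => ?_
    rcases Nat.eq_zero_or_pos j with hj | hj
    · subst hj; simp
    · obtain ⟨k, rfl⟩ : ∃ k, j = k + 1 := ⟨j - 1, (Nat.sub_add_cancel hj).symm⟩
      simp only [Nat.add_sub_cancel, pow_succ]
      ring
  -- the identity in the germ domain
  have hEO : germEval₂ z₀ ρO (coeffDeriv Q) + gO * germEval₂ z₀ ρO (weightDeg Q) = 0 := by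
    have hEan : AnalyticAt ℂ (fun z => ((coeffDeriv Q).map (Polynomial.evalRingHom z)).eval (ρ z) +
        g z * ((weightDeg Q).map (Polynomial.evalRingHom z)).eval (ρ z)) z₀ :=
      (analyticAt_evalPP hρan _).add (hgan.mul (analyticAt_evalPP hρan _))
    have h := (AGerm.mk_eq_zero_iff hEan).2 hE
    rw [germEval₂_mk, germEval₂_mk]
    exact h
  -- `D ≠ 0`
  have hDO : germEval₂ z₀ ρO (weightDeg Q) ≠ 0 := by
    rw [hρO, germEval₂_mk]
    exact AGerm.mk_ne_zero_of_apply_ne_zero _ hD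
  -- `D·g = -E`
  have hDg : germEval₂ z₀ ρO (weightDeg Q) * gO = -germEval₂ z₀ ρO (coeffDeriv Q) := by
    linear_combination hEO
  refine IsAlgebraic.of_mul (mem_nonZeroDivisors_of_ne_zero hDO) (isAlgebraic_germEval₂ hρalg _) ?_
  rw [hDg]
  exact (isAlgebraic_germEval₂ hρalg _).neg

/-! ## Part C. A relation for `exp(p(z) - P̃(z - L z))` makes `L` algebraic -/

/-- **The algebraic conclusion per branch.**  `L` analytic at `z₀` with `L' = g` near `z₀`, `g`
analytic at `z₀` with germ algebraic over `ℂ[zGerm]` and `g(z₀) ≠ 1`; `p, P̃ ∈ ℂ[X]` with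
`deg P̃ ≥ 2`; a nonzero `H ∈ ℂ[s][t]` with `H(z, exp(p(z) - P̃(z - L z))) = 0` near `z₀`.  Then the
germ of `L` is algebraic over `ℂ[zGerm]` (proof of file XII verbatim up to its last line).
[folklore differential algebra] (new in this form) -/
theorem isAlgebraic_log_of_graphExp_relation {z₀ : ℂ} {L g : ℂ → ℂ} (hLan : AnalyticAt ℂ L z₀)
    (hgan : AnalyticAt ℂ g z₀) (hL : ∀ᶠ z in 𝓝 z₀, HasDerivAt L (g z) z)
    (hgalg : IsAlgebraic (Algebra.adjoin ℂ ({zGerm z₀} : Set (AGerm z₀))) (AGerm.mk z₀ hgan))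
    (hg1 : g z₀ ≠ 1) (p Pt : ℂ[X]) (hPt : 2 ≤ Pt.natDegree) {H : ℂ[X][X]} (hH0 : H ≠ 0)
    (hH : ∀ᶠ z in 𝓝 z₀, (H.map (Polynomial.evalRingHom z)).eval
      (Complex.exp (p.eval z - Pt.eval (z - L z))) = 0) :
    IsAlgebraic (Algebra.adjoin ℂ ({zGerm z₀} : Set (AGerm z₀))) (AGerm.mk z₀ hLan) := by
  -- the functions and their germs
  have hsub : AnalyticAt ℂ (fun z => z - L z) z₀ := analyticAt_id.sub hLan
  have hPtan : AnalyticAt ℂ (fun z => Pt.eval (z - L z)) z₀ := analyticAt_polynomial_eval_comp hsub Pt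
  have hPt'an : AnalyticAt ℂ (fun z => (derivative Pt).eval (z - L z)) z₀ :=
    analyticAt_polynomial_eval_comp hsub (derivative Pt)
  set q : ℂ → ℂ := fun z => p.eval z - Pt.eval (z - L z) with hq
  have hqan : AnalyticAt ℂ q z₀ := (analyticAt_polynomial_eval p z₀).sub hPtan
  set w : ℂ → ℂ := fun z => Complex.exp (q z) with hw
  have hwan : AnalyticAt ℂ w z₀ := hqan.cexp
  set q' : ℂ → ℂ := fun z => (derivative p).eval z - (derivative Pt).eval (z - L z) * (1 - g z)
    with hq'
  have hq'an : AnalyticAt ℂ q' z₀ :=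
    (analyticAt_polynomial_eval _ z₀).sub (hPt'an.mul (analyticAt_const.sub hgan))
  set wO := AGerm.mk z₀ hwan with hwO
  set LO := AGerm.mk z₀ hLan with hLO
  set gO := AGerm.mk z₀ hgan with hgO
  have hwO0 : wO ≠ 0 := AGerm.mk_ne_zero_of_forall_ne_zero hwan fun z => Complex.exp_ne_zero _
  -- a relation of minimal degree
  have hHO : germEval₂ z₀ wO H = 0 := (germEval₂_mk_eq_zero_iff hwan H).2 hH
  clear hH
  obtain ⟨H, hH0, hHO, hmin⟩ := exists_minDegree_of_exists (germEval₂ z₀ wO) ⟨H, hH0, hHO⟩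
  set M := H.natDegree with hM
  -- the differentiated function identity
  have hF : (fun z => (H.map (Polynomial.evalRingHom z)).eval (w z)) =ᶠ[𝓝 z₀] 0 :=
    (germEval₂_mk_eq_zero_iff hwan H).1 hHO
  have hFF : ∀ᶠ z in 𝓝 z₀, (fun y => (H.map (Polynomial.evalRingHom y)).eval (w y)) =ᶠ[𝓝 z] 0 :=
    eventually_eventually_nhds.2 hF
  have hE : ∀ᶠ z in 𝓝 z₀, ((coeffDeriv H).map (Polynomial.evalRingHom z)).eval (w z) +
      q' z * ((weightDeg H).map (Polynomial.evalRingHom z)).eval (w z) = 0 := by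
    filter_upwards [hL, hFF] with z hLz hFz
    -- `q` and `w` are differentiable at `z` with `w' = w q'`
    have hqd : HasDerivAt q (q' z) z := by
      have h1 : HasDerivAt (fun y : ℂ => y - L y) (1 - g z) z := (hasDerivAt_id z).sub hLz
      have h2 : HasDerivAt (fun y => Pt.eval (y - L y))
          ((derivative Pt).eval (z - L z) * (1 - g z)) z :=
        HasDerivAt.comp z (h₂ := fun y => Pt.eval y) (Polynomial.hasDerivAt Pt (z - L z)) h1
      exact (Polynomial.hasDerivAt p z).sub h2
    have hwd : HasDerivAt w (w z * q' z) z := hqd.cexp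
    -- derivative of `F`
    have e : (fun y => (H.map (Polynomial.evalRingHom y)).eval (w y)) =
        fun y => ∑ j ∈ Finset.range (M + 1), (H.coeff j).eval y * w y ^ j :=
      funext fun y => evalPP_eq_sum H y (w y) (Nat.lt_succ_self _)
    have hderF : HasDerivAt (fun y => (H.map (Polynomial.evalRingHom y)).eval (w y))
        (∑ j ∈ Finset.range (M + 1), ((derivative (H.coeff j)).eval z * w z ^ j +
          (H.coeff j).eval z * ((j : ℂ) * w z ^ (j - 1) * (w z * q' z)))) z := by
      rw [e]
      exact HasDerivAt.fun_sum fun j _ => (Polynomial.hasDerivAt (H.coeff j) z).fun_mul (hwd.fun_pow j)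
    have hzero := hderF.unique ((hasDerivAt_const z (0 : ℂ)).congr_of_eventuallyEq hFz)
    rw [eval_coeffDeriv, eval_weightDeg, Finset.mul_sum, ← Finset.sum_add_distrib, ← hzero]
    refine Finset.sum_congr rfl fun j _ => ?_
    rcases Nat.eq_zero_or_pos j with hj | hj
    · subst hj; simp
    · obtain ⟨k, rfl⟩ : ∃ k, j = k + 1 := ⟨j - 1, (Nat.sub_add_cancel hj).symm⟩
      simp only [Nat.add_sub_cancel, pow_succ]
      ring
  -- the identity in the germ domain
  have hq'O : AGerm.mk z₀ hq'an =
      Polynomial.aeval (zGerm z₀) (derivative p) -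
        Polynomial.aeval (zGerm z₀ - LO) (derivative Pt) * (1 - gO) := by
    have hzL : zGerm z₀ - LO = AGerm.mk z₀ hsub := rfl
    rw [hzL, aeval_zGerm, aeval_mk hsub (derivative Pt) hPt'an]
    rfl
  have hEO : germEval₂ z₀ wO (coeffDeriv H) + AGerm.mk z₀ hq'an * germEval₂ z₀ wO (weightDeg H) = 0 := by
    have hEan : AnalyticAt ℂ (fun z => ((coeffDeriv H).map (Polynomial.evalRingHom z)).eval (w z) +
        q' z * ((weightDeg H).map (Polynomial.evalRingHom z)).eval (w z)) z₀ :=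
      (analyticAt_evalPP hwan _).add (hq'an.mul (analyticAt_evalPP hwan _))
    have h := (AGerm.mk_eq_zero_iff hEan).2 hE
    rw [germEval₂_mk, germEval₂_mk]
    exact h
  rw [hq'O] at hEO
  -- `D ≠ 0`, `1 - g ≠ 0`
  have hD : germEval₂ z₀ wO (weightDeg H) ≠ 0 := germEval₂_weightDeg_ne_zero hwO0 hH0 hHO hmin
  have h1g : (1 : AGerm z₀) - gO ≠ 0 := by
    have h1gan : AnalyticAt ℂ (fun z => 1 - g z) z₀ := analyticAt_const.sub hgan
    have : (1 : AGerm z₀) - gO = AGerm.mk z₀ h1gan := rfl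
    rw [this]
    exact AGerm.mk_ne_zero_of_apply_ne_zero h1gan (sub_ne_zero.2 (Ne.symm hg1))
  -- `δ β = ν` with `β = P̃'(z - L)`
  set β : AGerm z₀ := Polynomial.aeval (zGerm z₀ - LO) (derivative Pt) with hβ
  set δ : AGerm z₀ := (1 - gO) * germEval₂ z₀ wO (weightDeg H) with hδ
  set ν : AGerm z₀ := Polynomial.aeval (zGerm z₀) (derivative p) * germEval₂ z₀ wO (weightDeg H) +
    germEval₂ z₀ wO (coeffDeriv H) with hν
  have hδ0 : δ ≠ 0 := mul_ne_zero h1g hD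
  have hβδ : δ * β = ν := by
    rw [hδ, hν]
    linear_combination -hEO
  -- algebraicity over `ℂ[zGerm]`
  set Bz := Algebra.adjoin ℂ ({zGerm z₀} : Set (AGerm z₀)) with hBz
  have hwalg : IsAlgebraic Bz wO := isAlgebraic_of_germEval₂_eq_zero wO hH0 hHO
  have hzalg : IsAlgebraic Bz (zGerm z₀) := isAlgebraic_aeval_zGerm z₀ Polynomial.X |> fun h => by
    rwa [Polynomial.aeval_X] at h
  have hδalg : IsAlgebraic Bz δ := (isAlgebraic_one.sub hgalg).mul (isAlgebraic_germEval₂ hwalg _)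
  have hνalg : IsAlgebraic Bz ν :=
    ((isAlgebraic_aeval_zGerm z₀ _).mul (isAlgebraic_germEval₂ hwalg _)).add
      (isAlgebraic_germEval₂ hwalg _)
  have hβalg : IsAlgebraic Bz β :=
    IsAlgebraic.of_mul (mem_nonZeroDivisors_of_ne_zero hδ0) hδalg (by rw [hβδ]; exact hνalg)
  -- `z - L` is algebraic: `P̃'` has degree `≥ 1`
  have hγalg : IsAlgebraic Bz (zGerm z₀ - LO) := by
    have hinj : Function.Injective (algebraMap ℂ Bz) := (algebraMap ℂ Bz).injective
    set Qm : Polynomial Bz := (derivative Pt).map (algebraMap ℂ Bz) with hQm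
    have hQβ : Polynomial.aeval (zGerm z₀ - LO) Qm = β := by
      rw [hQm, Polynomial.aeval_map_algebraMap]
    have hdeg' : (derivative Pt).natDegree = Pt.natDegree - 1 := Polynomial.natDegree_derivative Pt
    have hQdeg : Qm.natDegree ≠ 0 := by
      rw [hQm, Polynomial.natDegree_map_eq_of_injective hinj, hdeg']
      omega
    have hPt'0 : derivative Pt ≠ 0 := by
      intro h
      rw [h, Polynomial.natDegree_zero] at hdeg'
      omega
    have hQlc : Qm.leadingCoeff ∈ nonZeroDivisors Bz := by
      refine mem_nonZeroDivisors_of_ne_zero ?_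
      rw [hQm, Polynomial.leadingCoeff_map_of_injective hinj, Ne, map_eq_zero_iff _ hinj]
      exact Polynomial.leadingCoeff_ne_zero.2 hPt'0
    exact IsAlgebraic.of_aeval Qm hQdeg hQlc (by rw [hQβ]; exact hβalg)
  have h := hzalg.sub hγalg
  rwa [sub_sub_cancel] at h

end Summit.Schanuel.Schanuel.Theorems
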